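import Summits.QuantumFields.YangMills.Theorems.ColdStartUniversalityLatticeLangevinTimeAverageHoeffdingCorrector
import HarnessLib

/-!
# Route `ColdStartUniversality` (fixed-cut-off SZZ dynamics): ★★★ THE POISSON (DYNKIN) MARTINGALE OF THE COLD-START PROCESS IS A MATHLIB
# `Martingale` — `M_t = u(U_t) − u(x) + ∫_(0,t] Ĝ(U_r) dr` w.r.t. the Brownian filtration, every coupling, every continuous `G`

Helper file (seat `ym-line-csu-p1`, g34; `--supports stmt-QuantumFields-24809`).  Files 70/73 used the increments of
`M_t := u(U_t) − u(U_0) + ∫_(0,t] Ĝ(U_r) dr` (`Ĝ = G − μ_(β')(G)`, `u` a bounded mild Poisson corrector: `κ_s u − u = −∫₀ˢ κ_r Ĝ dr`) only through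
their ORTHOGONALITY to bounded `𝓕^W`-measurable weights.  Here the full statement is recorded in Mathlib's language: for every realising kernel
family `κ`, every continuous bounded `G`, every bounded measurable corrector `u` of `Ĝ`, and every progressively measurable strong solution `U`
of the SU(2) SZZ dynamics from a deterministic start `x` on ANY probability space,
* ★★ `setIntegral_poissonMartingale_eq` — `∫_A M_t dP = ∫_A M_s dP` for `s ≤ t` and every `A ∈ 𝓕^W_s` (Markov property file 44, its time-integrated
  form file 69, the Poisson relation);
* ★★★ `martingale_poissonMartingale_of_prog` — **`M` is a `MeasureTheory.Martingale` with respect to `𝓕^W = σ(W_u : u ≤ t)` and `P`**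
  (adaptedness of the path integral: `measurable_setIntegral_path`; conditional expectations: `ae_eq_condExp_of_forall_setIntegral_eq`);
* ★★★ `exists_poissonMartingale` — packaged with g16's corrector (`exists_poisson_solution`): for every continuous `G` with `|G| ≤ 1` there is a
  continuous `u`, `|u| ≤ 2C/c`, such that `t ↦ u(U_t) − u(x) + ∫_(0,t] (G − μ_(β')G)(U_r) dr` is an `𝓕^W`-martingale along EVERY progressively
  measurable strong solution from every start (in particular along the regular flow / the cold start) — so Mathlib's optional stopping,
  convergence and maximal inequalities apply to the additive functionals `∫₀ᵗ G(U_r) dr` of the sampler.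
THEOREMS ONLY, no definition, no sorry; [folklore] (Dynkin's formula / the martingale problem, cf. [cite: RevuzYor1999, Ch. VII Prop. (1.6)]).
HONEST FRAMING: fixed cut-off; `UniformColdStartMixing` (24809) is NOT restated; no crux, rung or summit statement is proved; the Yang–Mills mass
gap is NOT proved.
-/

set_option autoImplicit false

noncomputable section

namespace Summit.QuantumFields.YangMills.Theorems.ColdStartUniversality

open MeasureTheory ProbabilityTheory Filter Topology Set
open scoped NNReal ENNReal BigOperators
open Literature Literature.Probability.Process Literature.MathematicalPhysics.QuantumFieldTheory
open Literature.MathematicalPhysics.QuantumLattice (fundamentalRep fundamentalLatticeRep continuous_fundamentalRep)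

variable {L : ℕ} [NeZero L]

/-- ★★ **Constancy of `A ↦ ∫_A M_t` in `t ≥ s` on `𝓕^W_s`.**  With `M_t = u(U_t) − u(x) + ∫_(0,t] Ĝ(U_r) dr` as in the module docstring
(`u` a bounded measurable mild Poisson corrector of `Ĝ = G − μ_(β')G`, `G` continuous bounded, `U` a jointly measurable strong solution from `x`):
for `s ≤ t` and every `A ∈ 𝓕^W_s`, `∫_A M_t dP = ∫_A M_s dP`. [folklore] -/
theorem setIntegral_poissonMartingale_eq (β' : ℝ)
    (κ : ℝ≥0 → Kernel (GaugeConfig 3 L (Matrix.specialUnitaryGroup (Fin 2) ℂ))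
      (GaugeConfig 3 L (Matrix.specialUnitaryGroup (Fin 2) ℂ))) [∀ t, IsMarkovKernel (κ t)]
    (hreal : ∀ (t : ℝ≥0) (x : GaugeConfig 3 L (Matrix.specialUnitaryGroup (Fin 2) ℂ))
        (Ω : Type) [MeasurableSpace Ω] (P : Measure Ω) [IsProbabilityMeasure P]
        (W : ℝ≥0 → Ω → (Edge 3 L × NoiseIdx 2 → ℝ)) (hW : IsFlatBrownian W P)
        (U : ℝ≥0 → Ω → GaugeConfig 3 L (Matrix.specialUnitaryGroup (Fin 2) ℂ)),
        (∀ ω, U 0 ω = x) →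
        (latticeLangevinDynamics (fundamentalLatticeRep 2) β').IsSolution (fundamentalRep (Fin 2))
          hW.natFiltration P W U →
        κ t x = P.map (U t))
    {G : GaugeConfig 3 L (Matrix.specialUnitaryGroup (Fin 2) ℂ) → ℝ} (hG : Continuous G) {CG : ℝ} (hGb : ∀ z, |G z| ≤ CG)
    {u : GaugeConfig 3 L (Matrix.specialUnitaryGroup (Fin 2) ℂ) → ℝ} (hum : Measurable u) {βu : ℝ} (hu_b : ∀ y, |u y| ≤ βu)
    (hPois : ∀ (s : ℝ≥0) (y : GaugeConfig 3 L (Matrix.specialUnitaryGroup (Fin 2) ℂ)),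
      (∫ z, u z ∂(κ s y)) - u y = -∫ t in (0 : ℝ)..(s : ℝ),
        (∫ z, (G z - ∫ z', G z' ∂(wilsonMeasure (d := 3) (L := L) (fundamentalRep (Fin 2)) β')) ∂(κ t.toNNReal y)))
    (x : GaugeConfig 3 L (Matrix.specialUnitaryGroup (Fin 2) ℂ))
    {Ω : Type} [MeasurableSpace Ω] {P : Measure Ω} [IsProbabilityMeasure P]
    {W : ℝ≥0 → Ω → (Edge 3 L × NoiseIdx 2 → ℝ)} (hW : IsFlatBrownian W P)
    {U : ℝ≥0 → Ω → GaugeConfig 3 L (Matrix.specialUnitaryGroup (Fin 2) ℂ)} (hU0 : ∀ ω, U 0 ω = x)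
    (hU : (latticeLangevinDynamics (fundamentalLatticeRep 2) β').IsSolution (fundamentalRep (Fin 2)) hW.natFiltration P W U)
    (hJ : Measurable fun q : Ω × ℝ => U q.2.toNNReal q.1)
    {s t : ℝ≥0} (hst : s ≤ t) {A : Set Ω} (hA : MeasurableSet[hW.natFiltration s] A) :
    ∫ ω in A, (u (U t ω) - u x + ∫ r in Ioc (0 : ℝ) (t : ℝ),
        (G (U r.toNNReal ω) - ∫ z', G z' ∂(wilsonMeasure (d := 3) (L := L) (fundamentalRep (Fin 2)) β'))) ∂P =
      ∫ ω in A, (u (U s ω) - u x + ∫ r in Ioc (0 : ℝ) (s : ℝ),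
        (G (U r.toNNReal ω) - ∫ z', G z' ∂(wilsonMeasure (d := 3) (L := L) (fundamentalRep (Fin 2)) β'))) ∂P := by
  classical
  haveI := secondCountableTopology_su2
  haveI := borelSpace_config L
  set m : ℝ := ∫ z', G z' ∂(wilsonMeasure (d := 3) (L := L) (fundamentalRep (Fin 2)) β') with hm
  set Gh : GaugeConfig 3 L (Matrix.specialUnitaryGroup (Fin 2) ℂ) → ℝ := fun z => G z - m with hGh
  have hGhc : Continuous Gh := hG.sub continuous_const
  have hGhm : Measurable Gh := hGhc.measurable
  have hGhb : ∀ z, |Gh z| ≤ CG + |m| := fun z => (abs_sub _ _).trans (add_le_add (hGb z) le_rfl)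
  have hmA : MeasurableSet A := hW.natFiltration.le s A hA
  have hmU : ∀ r : ℝ≥0, Measurable (U r) := fun r => (hU.adapted r).mono (hW.natFiltration.le r) le_rfl
  have hsec : ∀ ω, Measurable fun r : ℝ => Gh (U r.toNNReal ω) := fun ω => hGhm.comp (hJ.comp (measurable_const.prodMk measurable_id))
  have hii : ∀ ω (a a' : ℝ), IntervalIntegrable (fun r => Gh (U r.toNNReal ω)) volume a a' := fun ω a a' =>
    (intervalIntegrable_const (c := CG + |m|)).mono_fun' ((hsec ω).aestronglyMeasurable)
      (ae_of_all _ fun r => by simp only [Real.norm_eq_abs]; exact hGhb _)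
  -- the time increment `τ = t − s`
  set τ : ℝ≥0 := t - s with hτ
  have hts : t = s + τ := by rw [hτ, add_tsub_cancel_of_le hst]
  have hτr : ((t : ℝ≥0) : ℝ) = s + τ := by rw [hts, NNReal.coe_add]
  -- the weight `Z = 1_A`
  set Z : Ω → ℝ := A.indicator fun _ => (1 : ℝ) with hZ
  have hZF : Measurable[hW.natFiltration s] Z := measurable_const.indicator hA
  have hZm : Measurable Z := hZF.mono (hW.natFiltration.le s) le_rfl
  have hZb : ∀ ω, |Z ω| ≤ 1 := fun ω => by by_cases h : ω ∈ A <;> simp [hZ, h]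
  -- (a) Markov property: `E[Z u(U_t)] = E[Z κ_τ u(U_s)]`
  have e1 : ∫ ω, Z ω * u (U t ω) ∂P = ∫ ω, Z ω * (∫ z, u z ∂(κ τ (U s ω))) ∂P := by
    rw [hts]
    exact integral_mul_comp_add_eq_integral_mul_transition β' κ hreal x hW hU0 hU s τ hZF hZb hum hu_b
  -- (b) time-integrated Markov property: `E[Z ∫_(s,t] Ĝ(U_r) dr] = E[Z ∫_(0,τ] κ_v Ĝ(U_s) dv]`
  have e2 : ∫ ω, Z ω * (∫ r in Ioc (s : ℝ) (s + τ), Gh (U r.toNNReal ω)) ∂P =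
      ∫ ω, Z ω * (∫ v in Ioc (0 : ℝ) τ, ∫ z, Gh z ∂(κ v.toNNReal (U s ω))) ∂P :=
    integral_mul_setIntegral_comp_eq_integral_mul_setIntegral_transition β' κ hreal x hW hU0 hU hJ s (NNReal.coe_nonneg τ) hZF hZb hGhc hGhb
  -- (c) Poisson relation: `∫_(0,τ] κ_v Ĝ(y) dv = u(y) − κ_τ u(y)`
  have e3 : ∀ y, (∫ v in Ioc (0 : ℝ) τ, ∫ z, Gh z ∂(κ v.toNNReal y)) = u y - ∫ z, u z ∂(κ τ y) := fun y => by
    have hp := hPois τ y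
    rw [← intervalIntegral.integral_of_le (NNReal.coe_nonneg τ)]
    simp only [hGh, hm]
    linarith
  -- integrability of the bounded pieces
  have hκum : Measurable fun y => ∫ z, u z ∂(κ τ y) := (hum.stronglyMeasurable.integral_kernel (κ := κ τ)).measurable
  have hκub : ∀ y, |∫ z, u z ∂(κ τ y)| ≤ βu := fun y => by
    have hh := norm_integral_le_of_norm_le_const (μ := κ τ y) (f := u) (C := βu) (Eventually.of_forall fun z => by simpa [Real.norm_eq_abs] using hu_b z)
    simpa [Real.norm_eq_abs] using hh
  have hIm : ∀ (a b : ℝ), Measurable fun ω => ∫ r in Ioc a b, Gh (U r.toNNReal ω) := fun a b => by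
    have h1 : Measurable (Function.uncurry fun (ω : Ω) (r : ℝ) => Gh (U r.toNNReal ω)) := hGhm.comp hJ
    exact (h1.stronglyMeasurable.integral_prod_right (ν := volume.restrict (Ioc a b))).measurable
  have hIb : ∀ (a b : ℝ) ω, a ≤ b → |∫ r in Ioc a b, Gh (U r.toNNReal ω)| ≤ (CG + |m|) * (b - a) := fun a b ω hab => by
    have hh := norm_setIntegral_le_of_norm_le_const (μ := volume) (s := Ioc a b) measure_Ioc_lt_top
      (fun r _ => show ‖Gh (U r.toNNReal ω)‖ ≤ CG + |m| by rw [Real.norm_eq_abs]; exact hGhb _) (f := fun r => Gh (U r.toNNReal ω))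
    rwa [Real.norm_eq_abs, Real.volume_real_Ioc_of_le hab] at hh
  have hInt : ∀ {φ : Ω → ℝ} {Cφ : ℝ}, Measurable φ → (∀ ω, |φ ω| ≤ Cφ) → Integrable (fun ω => Z ω * φ ω) P :=
    fun {φ Cφ} hφ hφb => (integrable_const (1 * Cφ)).mono' (hZm.mul hφ).aestronglyMeasurable
      (Eventually.of_forall fun ω => by
        rw [norm_mul, Real.norm_eq_abs, Real.norm_eq_abs]
        exact mul_le_mul (hZb ω) (hφb ω) (abs_nonneg _) zero_le_one)
  have i1 : Integrable (fun ω => Z ω * u (U t ω)) P := hInt (hum.comp (hmU _)) fun ω => hu_b _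
  have i2 : Integrable (fun ω => Z ω * u (U s ω)) P := hInt (hum.comp (hmU _)) fun ω => hu_b _
  have i3 : Integrable (fun ω => Z ω * ∫ r in Ioc (s : ℝ) (s + τ), Gh (U r.toNNReal ω)) P :=
    hInt (hIm _ _) fun ω => hIb _ _ ω (by simp)
  have i4 : Integrable (fun ω => Z ω * ∫ z, u z ∂(κ τ (U s ω))) P := hInt (hκum.comp (hmU _)) fun ω => hκub _
  -- `E[Z (M_t − M_s)] = 0`
  have hsplitI : ∀ ω, (∫ r in Ioc (0 : ℝ) (t : ℝ), Gh (U r.toNNReal ω)) =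
      (∫ r in Ioc (0 : ℝ) (s : ℝ), Gh (U r.toNNReal ω)) + ∫ r in Ioc (s : ℝ) (s + τ), Gh (U r.toNNReal ω) := by
    intro ω
    rw [← intervalIntegral.integral_of_le (NNReal.coe_nonneg s), ← intervalIntegral.integral_of_le (NNReal.coe_nonneg t), hτr,
      ← intervalIntegral.integral_of_le (le_add_of_nonneg_right (NNReal.coe_nonneg τ)),
      intervalIntegral.integral_add_adjacent_intervals (hii ω _ _) (hii ω _ _)]
  have hzero : ∫ ω, Z ω * ((u (U t ω) - u x + ∫ r in Ioc (0 : ℝ) (t : ℝ), Gh (U r.toNNReal ω)) -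
      (u (U s ω) - u x + ∫ r in Ioc (0 : ℝ) (s : ℝ), Gh (U r.toNNReal ω))) ∂P = 0 := by
    have hpt : ∀ ω, Z ω * ((u (U t ω) - u x + ∫ r in Ioc (0 : ℝ) (t : ℝ), Gh (U r.toNNReal ω)) -
        (u (U s ω) - u x + ∫ r in Ioc (0 : ℝ) (s : ℝ), Gh (U r.toNNReal ω))) =
        (Z ω * u (U t ω) - Z ω * u (U s ω)) + Z ω * ∫ r in Ioc (s : ℝ) (s + τ), Gh (U r.toNNReal ω) := fun ω => by
      rw [hsplitI ω]; ring
    rw [integral_congr_ae (ae_of_all _ hpt),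
      integral_add (f := fun ω => Z ω * u (U t ω) - Z ω * u (U s ω)) (i1.sub i2) i3, integral_sub i1 i2, e1, e2]
    have e23 : ∫ ω, Z ω * (∫ v in Ioc (0 : ℝ) τ, ∫ z, Gh z ∂(κ v.toNNReal (U s ω))) ∂P =
        (∫ ω, Z ω * u (U s ω) ∂P) - ∫ ω, Z ω * (∫ z, u z ∂(κ τ (U s ω))) ∂P := by
      rw [← integral_sub i2 i4]
      exact integral_congr_ae (ae_of_all _ fun ω => by dsimp only; rw [e3, mul_sub])
    rw [e23]
    ring
  -- back to set integrals
  have iMt : Integrable (fun ω => Z ω * (u (U t ω) - u x + ∫ r in Ioc (0 : ℝ) (t : ℝ), Gh (U r.toNNReal ω))) P :=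
    hInt (((hum.comp (hmU _)).sub measurable_const).add (hIm _ _)) fun ω =>
      (abs_add_le _ _).trans (add_le_add ((abs_sub _ _).trans (add_le_add (hu_b _) (hu_b _))) (hIb _ _ ω (NNReal.coe_nonneg t)))
  have iMs : Integrable (fun ω => Z ω * (u (U s ω) - u x + ∫ r in Ioc (0 : ℝ) (s : ℝ), Gh (U r.toNNReal ω))) P :=
    hInt (((hum.comp (hmU _)).sub measurable_const).add (hIm _ _)) fun ω =>
      (abs_add_le _ _).trans (add_le_add ((abs_sub _ _).trans (add_le_add (hu_b _) (hu_b _))) (hIb _ _ ω (NNReal.coe_nonneg s)))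
  have hLt : ∫ ω in A, (u (U t ω) - u x + ∫ r in Ioc (0 : ℝ) (t : ℝ), Gh (U r.toNNReal ω)) ∂P =
      ∫ ω, Z ω * (u (U t ω) - u x + ∫ r in Ioc (0 : ℝ) (t : ℝ), Gh (U r.toNNReal ω)) ∂P := by
    rw [← integral_indicator hmA]
    exact integral_congr_ae (ae_of_all _ fun ω => by by_cases h : ω ∈ A <;> simp [hZ, h])
  have hLs : ∫ ω in A, (u (U s ω) - u x + ∫ r in Ioc (0 : ℝ) (s : ℝ), Gh (U r.toNNReal ω)) ∂P =
      ∫ ω, Z ω * (u (U s ω) - u x + ∫ r in Ioc (0 : ℝ) (s : ℝ), Gh (U r.toNNReal ω)) ∂P := by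
    rw [← integral_indicator hmA]
    exact integral_congr_ae (ae_of_all _ fun ω => by by_cases h : ω ∈ A <;> simp [hZ, h])
  have hsub := integral_sub iMt iMs
  have heq : ∫ ω, (Z ω * (u (U t ω) - u x + ∫ r in Ioc (0 : ℝ) (t : ℝ), Gh (U r.toNNReal ω)) -
      Z ω * (u (U s ω) - u x + ∫ r in Ioc (0 : ℝ) (s : ℝ), Gh (U r.toNNReal ω))) ∂P = 0 := by
    exact (integral_congr_ae (ae_of_all _ fun ω => by ring)).trans hzero
  show ∫ ω in A, (u (U t ω) - u x + ∫ r in Ioc (0 : ℝ) (t : ℝ), Gh (U r.toNNReal ω)) ∂P =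
    ∫ ω in A, (u (U s ω) - u x + ∫ r in Ioc (0 : ℝ) (s : ℝ), Gh (U r.toNNReal ω)) ∂P
  rw [hLt, hLs]
  linarith

/-- ★★★ **The Poisson (Dynkin) martingale is a Mathlib `Martingale`.**  For every realising kernel family `κ`, continuous bounded `G`, bounded
measurable mild Poisson corrector `u` of `Ĝ = G − μ_(β')G`, and every strong solution `U` from a deterministic start `x` whose restrictions to
`[0,i] × Ω` are `𝓑([0,i]) ⊗ 𝓕^W_i`-measurable (e.g. the regular flow), the process `M_t = u(U_t) − u(x) + ∫_(0,t] Ĝ(U_r) dr` is a martingale with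
respect to the Brownian filtration `𝓕^W` and `P`. [cite: RevuzYor1999, Ch. VII Prop. (1.6)] -/
theorem martingale_poissonMartingale_of_prog (β' : ℝ)
    (κ : ℝ≥0 → Kernel (GaugeConfig 3 L (Matrix.specialUnitaryGroup (Fin 2) ℂ))
      (GaugeConfig 3 L (Matrix.specialUnitaryGroup (Fin 2) ℂ))) [∀ t, IsMarkovKernel (κ t)]
    (hreal : ∀ (t : ℝ≥0) (x : GaugeConfig 3 L (Matrix.specialUnitaryGroup (Fin 2) ℂ))
        (Ω : Type) [MeasurableSpace Ω] (P : Measure Ω) [IsProbabilityMeasure P]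
        (W : ℝ≥0 → Ω → (Edge 3 L × NoiseIdx 2 → ℝ)) (hW : IsFlatBrownian W P)
        (U : ℝ≥0 → Ω → GaugeConfig 3 L (Matrix.specialUnitaryGroup (Fin 2) ℂ)),
        (∀ ω, U 0 ω = x) →
        (latticeLangevinDynamics (fundamentalLatticeRep 2) β').IsSolution (fundamentalRep (Fin 2))
          hW.natFiltration P W U →
        κ t x = P.map (U t))
    {G : GaugeConfig 3 L (Matrix.specialUnitaryGroup (Fin 2) ℂ) → ℝ} (hG : Continuous G) {CG : ℝ} (hGb : ∀ z, |G z| ≤ CG)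
    {u : GaugeConfig 3 L (Matrix.specialUnitaryGroup (Fin 2) ℂ) → ℝ} (hum : Measurable u) {βu : ℝ} (hu_b : ∀ y, |u y| ≤ βu)
    (hPois : ∀ (s : ℝ≥0) (y : GaugeConfig 3 L (Matrix.specialUnitaryGroup (Fin 2) ℂ)),
      (∫ z, u z ∂(κ s y)) - u y = -∫ t in (0 : ℝ)..(s : ℝ),
        (∫ z, (G z - ∫ z', G z' ∂(wilsonMeasure (d := 3) (L := L) (fundamentalRep (Fin 2)) β')) ∂(κ t.toNNReal y)))
    (x : GaugeConfig 3 L (Matrix.specialUnitaryGroup (Fin 2) ℂ))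
    {Ω : Type} [MeasurableSpace Ω] {P : Measure Ω} [IsProbabilityMeasure P]
    {W : ℝ≥0 → Ω → (Edge 3 L × NoiseIdx 2 → ℝ)} (hW : IsFlatBrownian W P)
    {U : ℝ≥0 → Ω → GaugeConfig 3 L (Matrix.specialUnitaryGroup (Fin 2) ℂ)} (hU0 : ∀ ω, U 0 ω = x)
    (hU : (latticeLangevinDynamics (fundamentalLatticeRep 2) β').IsSolution (fundamentalRep (Fin 2)) hW.natFiltration P W U)
    (hprog : ∀ i : ℝ≥0, Measurable[@Prod.instMeasurableSpace (Set.Iic i) Ω inferInstance (hW.natFiltration i)]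
      (fun q : Set.Iic i × Ω => U q.1 q.2)) :
    Martingale (fun (t : ℝ≥0) (ω : Ω) => u (U t ω) - u x + ∫ r in Ioc (0 : ℝ) (t : ℝ),
        (G (U r.toNNReal ω) - ∫ z', G z' ∂(wilsonMeasure (d := 3) (L := L) (fundamentalRep (Fin 2)) β'))) hW.natFiltration P := by
  classical
  haveI := secondCountableTopology_su2
  haveI := borelSpace_config L
  set m : ℝ := ∫ z', G z' ∂(wilsonMeasure (d := 3) (L := L) (fundamentalRep (Fin 2)) β') with hm
  have hGhm : Measurable fun z => G z - m := (hG.sub continuous_const).measurable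
  have hGhb : ∀ z, |G z - m| ≤ CG + |m| := fun z => (abs_sub _ _).trans (add_le_add (hGb z) le_rfl)
  have hJ : Measurable fun q : Ω × ℝ => U q.2.toNNReal q.1 :=
    measurable_uncurry_of_prog (Z := U) (fun n : ℕ => hW.natFiltration n) (fun n => hW.natFiltration.le n) (fun n => hprog n)
  have hmU : ∀ r : ℝ≥0, Measurable (U r) := fun r => (hU.adapted r).mono (hW.natFiltration.le r) le_rfl
  -- adaptedness
  have hMF : ∀ t : ℝ≥0, Measurable[hW.natFiltration t] fun ω => u (U t ω) - u x + ∫ r in Ioc (0 : ℝ) (t : ℝ), (G (U r.toNNReal ω) - m) := by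
    intro t
    have h1 : Measurable[hW.natFiltration t] fun ω => u (U t ω) := hum.comp (hU.adapted t)
    have h2 : Measurable[hW.natFiltration t] fun ω => ∫ r in Ioc (0 : ℝ) (t : ℝ), (G (U r.toNNReal ω) - m) :=
      measurable_setIntegral_path (mΩ := hW.natFiltration t) t (hprog t) hGhm le_rfl le_rfl
    exact (h1.sub measurable_const).add h2
  refine ⟨fun t => stronglyMeasurable_real_of_measurable (hMF t), fun s t hst => ?_⟩
  -- conditional expectations through set integrals
  have hms : hW.natFiltration s ≤ ‹MeasurableSpace Ω› := hW.natFiltration.le s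
  have hIm : ∀ (b : ℝ), Measurable fun ω => ∫ r in Ioc (0 : ℝ) b, (G (U r.toNNReal ω) - m) := fun b => by
    have h1 : Measurable (Function.uncurry fun (ω : Ω) (r : ℝ) => G (U r.toNNReal ω) - m) := hGhm.comp hJ
    exact (h1.stronglyMeasurable.integral_prod_right (ν := volume.restrict (Ioc 0 b))).measurable
  have hIb : ∀ (b : ℝ) ω, 0 ≤ b → |∫ r in Ioc (0 : ℝ) b, (G (U r.toNNReal ω) - m)| ≤ (CG + |m|) * b := fun b ω hb => by
    have hh := norm_setIntegral_le_of_norm_le_const (μ := volume) (s := Ioc (0 : ℝ) b) measure_Ioc_lt_top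
      (fun r _ => show ‖G (U r.toNNReal ω) - m‖ ≤ CG + |m| by rw [Real.norm_eq_abs]; exact hGhb _) (f := fun r => G (U r.toNNReal ω) - m)
    rwa [Real.norm_eq_abs, Real.volume_real_Ioc_of_le hb, sub_zero] at hh
  have hMint : ∀ r : ℝ≥0, Integrable (fun ω => u (U r ω) - u x + ∫ v in Ioc (0 : ℝ) (r : ℝ), (G (U v.toNNReal ω) - m)) P := fun r =>
    (integrable_const (βu + βu + (CG + |m|) * r)).mono' ((((hum.comp (hmU r)).sub measurable_const).add (hIm r)).aestronglyMeasurable)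
      (Eventually.of_forall fun ω => by
        rw [Real.norm_eq_abs]
        exact (abs_add_le _ _).trans (add_le_add ((abs_sub _ _).trans (add_le_add (hu_b _) (hu_b _))) (hIb _ ω (NNReal.coe_nonneg r))))
  refine (ae_eq_condExp_of_forall_setIntegral_eq hms (hMint t) (fun A _ _ => (hMint s).integrableOn) (fun A hA _ => ?_)
    (stronglyMeasurable_real_of_measurable (hMF s)).aestronglyMeasurable).symm
  exact (setIntegral_poissonMartingale_eq β' κ hreal hG hGb hum hu_b hPois x hW hU0 hU hJ hst hA).symm

/-- ★★★ **Existence of the Poisson martingale for every continuous observable** (every coupling; `C, c` depend on `L, β'`): there are `C, c > 0`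
such that for every realising kernel family `κ` and every continuous `G` with `|G| ≤ 1` there is a continuous corrector `u` with `|u| ≤ 2C/c`
solving the mild Poisson equation for `Ĝ = G − μ_(β')G`, such that along EVERY progressively measurable strong solution `U` of the SU(2) SZZ
dynamics from every deterministic start `x` on ANY probability space, `t ↦ u(U_t) − u(x) + ∫_(0,t] Ĝ(U_r) dr` is an `𝓕^W`-martingale. [folklore] -/
theorem exists_poissonMartingale (L : ℕ) [NeZero L] (β' : ℝ) :
    ∃ C c : ℝ, 0 < C ∧ 0 < c ∧
      ∀ (κ : ℝ≥0 → Kernel (GaugeConfig 3 L (Matrix.specialUnitaryGroup (Fin 2) ℂ))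
          (GaugeConfig 3 L (Matrix.specialUnitaryGroup (Fin 2) ℂ))) [∀ t, IsMarkovKernel (κ t)],
        (∀ (t : ℝ≥0) (x : GaugeConfig 3 L (Matrix.specialUnitaryGroup (Fin 2) ℂ))
          (Ω : Type) [MeasurableSpace Ω] (P : Measure Ω) [IsProbabilityMeasure P]
          (W : ℝ≥0 → Ω → (Edge 3 L × NoiseIdx 2 → ℝ)) (hW : IsFlatBrownian W P)
          (U : ℝ≥0 → Ω → GaugeConfig 3 L (Matrix.specialUnitaryGroup (Fin 2) ℂ)),
          (∀ ω, U 0 ω = x) →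
          (latticeLangevinDynamics (fundamentalLatticeRep 2) β').IsSolution (fundamentalRep (Fin 2))
            hW.natFiltration P W U →
          κ t x = P.map (U t)) →
        ∀ (G : GaugeConfig 3 L (Matrix.specialUnitaryGroup (Fin 2) ℂ) → ℝ), Continuous G → (∀ z, |G z| ≤ 1) →
          ∃ u : GaugeConfig 3 L (Matrix.specialUnitaryGroup (Fin 2) ℂ) → ℝ, Continuous u ∧ (∀ y, |u y| ≤ 2 * C / c) ∧
            (∀ (s : ℝ≥0) (y : GaugeConfig 3 L (Matrix.specialUnitaryGroup (Fin 2) ℂ)),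
              (∫ z, u z ∂(κ s y)) - u y = -∫ t in (0 : ℝ)..(s : ℝ),
                (∫ z, (G z - ∫ z', G z' ∂(wilsonMeasure (d := 3) (L := L) (fundamentalRep (Fin 2)) β')) ∂(κ t.toNNReal y))) ∧
            ∀ (x : GaugeConfig 3 L (Matrix.specialUnitaryGroup (Fin 2) ℂ))
              (Ω : Type) [MeasurableSpace Ω] (P : Measure Ω) [IsProbabilityMeasure P]
              (W : ℝ≥0 → Ω → (Edge 3 L × NoiseIdx 2 → ℝ)) (hW : IsFlatBrownian W P)
              (U : ℝ≥0 → Ω → GaugeConfig 3 L (Matrix.specialUnitaryGroup (Fin 2) ℂ)),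
              (∀ ω, U 0 ω = x) →
              (latticeLangevinDynamics (fundamentalLatticeRep 2) β').IsSolution (fundamentalRep (Fin 2)) hW.natFiltration P W U →
              (∀ i : ℝ≥0, Measurable[@Prod.instMeasurableSpace (Set.Iic i) Ω inferInstance (hW.natFiltration i)]
                (fun q : Set.Iic i × Ω => U q.1 q.2)) →
              Martingale (fun (t : ℝ≥0) (ω : Ω) => u (U t ω) - u x + ∫ r in Ioc (0 : ℝ) (t : ℝ),
                (G (U r.toNNReal ω) - ∫ z', G z' ∂(wilsonMeasure (d := 3) (L := L) (fundamentalRep (Fin 2)) β'))) hW.natFiltration P := by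
  classical
  haveI := secondCountableTopology_su2
  haveI := borelSpace_config L
  haveI : IsProbabilityMeasure (wilsonMeasure (d := 3) (L := L) (fundamentalRep (Fin 2)) β') :=
    isProbabilityMeasure_wilsonMeasure (d := 3) (L := L) (fundamentalRep (Fin 2)) (continuous_fundamentalRep (Fin 2)) β'
  obtain ⟨C, c, hC, hc, hP⟩ := exists_poisson_solution L β'
  refine ⟨C, c, hC, hc, fun κ _ hreal G hG hG1 => ?_⟩
  set m : ℝ := ∫ z', G z' ∂(wilsonMeasure (d := 3) (L := L) (fundamentalRep (Fin 2)) β') with hm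
  have hm1 : |m| ≤ 1 := by
    have hh := norm_integral_le_of_norm_le_const (μ := wilsonMeasure (d := 3) (L := L) (fundamentalRep (Fin 2)) β') (f := G) (C := 1)
      (Eventually.of_forall fun z => by simpa [Real.norm_eq_abs] using hG1 z)
    simpa [Real.norm_eq_abs] using hh
  have hGhc : Continuous fun z => G z - m := hG.sub continuous_const
  have hGhb : ∀ z, |G z - m| ≤ 2 := fun z => (abs_sub _ _).trans (by linarith [hG1 z, hm1])
  have hGh0 : ∫ z, (G z - m) ∂(wilsonMeasure (d := 3) (L := L) (fundamentalRep (Fin 2)) β') = 0 := by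
    have hGi : Integrable G (wilsonMeasure (d := 3) (L := L) (fundamentalRep (Fin 2)) β') :=
      (integrable_const (1 : ℝ)).mono' hG.measurable.aestronglyMeasurable (Eventually.of_forall fun z => by simpa [Real.norm_eq_abs] using hG1 z)
    rw [integral_sub hGi (integrable_const m), integral_const, smul_eq_mul, probReal_univ, one_mul, hm, sub_self]
  obtain ⟨u, hu_c, -, hu_b, -, hPois⟩ := hP κ hreal (fun z => G z - m) hGhc hGh0 2 hGhb
  refine ⟨u, hu_c, hu_b, hPois, fun x Ω _ P _ W hW U hU0 hU hprog => ?_⟩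
  exact martingale_poissonMartingale_of_prog β' κ hreal hG hG1 hu_c.measurable hu_b hPois x hW hU0 hU hprog

end Summit.QuantumFields.YangMills.Theorems.ColdStartUniversality

end
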